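import Mathlib.Analysis.Complex.Liouville
import Literature.Analysis.Complex.ExpTypeIndicator
import Literature.Analysis.Fourier.FourierCompactSupportAnalytic
import Literature.Analysis.Fourier.FourierUniquenessL1
import Literature.Analysis.Fourier.HolomorphicParamIntegral
import HarnessLib

/-!
# Exponential decay of a Laplace transform forces the density to vanish near `0`

Topic `Literature/Analysis/Complex`. Everything in this file is PROVED (no named facts).

Let `m ∈ L¹(ℝ)` vanish a.e. on `(-∞, 0)` and let `G(X) = ∫ e^{-tX} m(t) dt` be its Laplace
transform along the real axis. If `‖G(X)‖ ≤ C e^{-κX}` for all large real `X`, with `κ > 0`, then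
`m = 0` a.e. on `(-∞, κ)` (`ae_eq_zero_of_laplace_exp_decay`). This is the one-variable,
real-axis form of Pólya's theorem on the indicator of a Laplace–Borel transform (Boas,
*Entire Functions*, §5.3–§5.4: the indicator of `∫ e^{zw} dμ(w)` in the direction `θ` is the
support function of the convex hull of the support of `μ`; here `h(π) = -inf supp m`), i.e. the
statement "the abscissa of exponential decay of `G` is the left end-point of the support of `m`".

## Proof

Split `m = m₁ + m₂` with `m₁ = 1_{[0,κ)} m`. For real `X ≥ 0` the piece `m₂` (supported in
`[κ, ∞)` up to a null set) trivially has `‖∫ e^{-tX} m₂‖ ≤ e^{-κX} ‖m‖₁`, so the Laplace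
transform `G₁` of the compactly supported piece `m₁` is also `O(e^{-κX})`
(`norm_laplace_indicator_Ico_le`). Now `E(z) = e^{κz} G₁(z) = ∫ e^{(κ-t)z} m₁(t) dt` is entire
(`differentiable_laplace_of_forall_notMem_Ico`, differentiation under the integral sign),
of exponential type `κ`, bounded by `‖m₁‖₁` on the closed left half-plane
(`norm_cexp_mul_laplace_le`) and bounded on the positive real axis by the decay hypothesis; the
Phragmén–Lindelöf principle in the two right quadrants
(`Literature.Analysis.Complex.norm_le_exp_of_re_nonneg`) makes `E` bounded on `ℂ`, hence
constant by Liouville, and the constant is `lim_{X→+∞} E(-X) = 0` by dominated convergence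
(`tendsto_cexp_mul_laplace_atTop`). Thus `G₁ ≡ 0`; at `z = 2πiξ` this says `𝓕 m₁ = 0`, so
`m₁ = 0` a.e. by `L¹` Fourier uniqueness
(`Literature.Analysis.Fourier.ae_eq_zero_of_forall_fourier_eq_zero`).

## References

* [Boas1954] R. P. Boas, *Entire Functions*, Academic Press 1954, §5.3 (the Borel/Laplace
  transform and the conjugate indicator diagram, Pólya's theorem), §5.4 (properties of the
  indicator).
* G. Doetsch, *Handbuch der Laplace-Transformation*, Band I, Birkhäuser 1950, Kap. 3
  (abscissae of convergence, uniqueness of the Laplace transform) — secondary.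

What is NOT here: the general indicator diagram (all directions `θ`), measures instead of `L¹`
densities, and the converse (support in `[κ, ∞)` ⇒ decay), which is elementary.
-/

noncomputable section

namespace Literature.Analysis.Complex

open _root_.MeasureTheory Set Filter Metric Bornology _root_.Complex
open scoped FourierTransform Real Topology

/-! ### Kernel computations -/

/-- Real part of the Laplace exponent: `Re(-t z) = -t Re z` for real `t`. [folklore] -/
theorem re_neg_ofReal_mul (t : ℝ) (z : ℂ) : (-(t : ℂ) * z).re = -(t * z.re) := by
  rw [neg_mul, neg_re, re_ofReal_mul]

/-- Norm of the Laplace kernel: `‖e^{-tz}‖ = e^{-t Re z}` for real `t`. [folklore] -/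
theorem norm_cexp_neg_ofReal_mul (t : ℝ) (z : ℂ) :
    ‖cexp (-(t : ℂ) * z)‖ = Real.exp (-(t * z.re)) := by
  rw [Complex.norm_exp, re_neg_ofReal_mul]

/-! ### The Laplace transform of an `L¹` function supported in `[0, κ)` -/

/-- **The Laplace transform of an integrable function supported in `[0, κ)` is entire**
(differentiation under the integral sign, via the tree's
`differentiableOn_integral_of_dominated_holomorphic` on every disc). [folklore] -/
theorem differentiable_laplace_of_forall_notMem_Ico {f : ℝ → ℂ} {κ : ℝ} (hf : Integrable f)
    (hsupp : ∀ t, t ∉ Ico 0 κ → f t = 0) :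
    Differentiable ℂ fun z : ℂ => ∫ t : ℝ, cexp (-(t : ℂ) * z) * f t := by
  intro z₀
  set R : ℝ := ‖z₀‖ + 1 with hR
  have hmem : z₀ ∈ ball (0 : ℂ) R := by
    rw [mem_ball, dist_zero_right, hR]; exact lt_add_one _
  suffices h : DifferentiableOn ℂ (fun z : ℂ => ∫ t : ℝ, cexp (-(t : ℂ) * z) * f t)
      (ball (0 : ℂ) R) from h.differentiableAt (isOpen_ball.mem_nhds hmem)
  refine Literature.Analysis.Fourier.differentiableOn_integral_of_dominated_holomorphic isOpen_ball
    (K := fun (z : ℂ) (t : ℝ) => cexp (-(t : ℂ) * z) * f t) (B := fun t => Real.exp (κ * R) * ‖f t‖)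
    (fun w _ => ?_) (Eventually.of_forall fun t => ?_) (Eventually.of_forall fun t w hw => ?_)
    (hf.norm.const_mul _)
  · exact (Continuous.aestronglyMeasurable (by fun_prop)).mul hf.aestronglyMeasurable
  · exact ((differentiable_id.const_mul (-(t : ℂ))).cexp.mul_const (f t)).differentiableOn
  · by_cases ht : t ∈ Ico 0 κ
    · rw [norm_mul, norm_cexp_neg_ofReal_mul]
      gcongr
      rw [mem_ball, dist_zero_right] at hw
      have h1 : -w.re ≤ ‖w‖ := by
        have h := abs_re_le_norm w
        rw [abs_le] at h
        linarith [h.1]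
      have h2 : t * -w.re ≤ t * ‖w‖ := mul_le_mul_of_nonneg_left h1 ht.1
      have h3 : t * ‖w‖ ≤ κ * R := mul_le_mul ht.2.le hw.le (norm_nonneg _) (ht.1.trans ht.2.le)
      linarith
    · simp [hsupp t ht]

/-- Growth of `E(z) = e^{κz} ∫ e^{-tz} f(t) dt = ∫ e^{(κ-t)z} f(t) dt` for `f` supported in
`[0, κ)`: `‖E(z)‖ ≤ e^{κ max(Re z, 0)} ‖f‖₁`; in particular `E` is bounded by `‖f‖₁` on the closed
left half-plane and of exponential type `κ`. [folklore] -/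
theorem norm_cexp_mul_laplace_le {f : ℝ → ℂ} {κ : ℝ} (hf : Integrable f)
    (hsupp : ∀ t, t ∉ Ico 0 κ → f t = 0) (z : ℂ) :
    ‖cexp (κ * z) * ∫ t : ℝ, cexp (-(t : ℂ) * z) * f t‖ ≤
      Real.exp (κ * max z.re 0) * ∫ t, ‖f t‖ := by
  rw [← integral_const_mul, ← integral_const_mul]
  refine norm_integral_le_of_norm_le (hf.norm.const_mul _) (Eventually.of_forall fun t => ?_)
  by_cases ht : t ∈ Ico 0 κ
  · rw [norm_mul, norm_mul, ← mul_assoc, Complex.norm_exp, norm_cexp_neg_ofReal_mul,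
      ← Real.exp_add, re_ofReal_mul]
    gcongr
    have h1 : z.re ≤ max z.re 0 := le_max_left _ _
    have h2 : 0 ≤ max z.re 0 := le_max_right _ _
    nlinarith [mul_le_mul_of_nonneg_left h1 (sub_pos.2 ht.2).le, mul_nonneg ht.1 h2]
  · simp [hsupp t ht]

/-- The limit `E(-X) = ∫ e^{-(κ-t)X} f(t) dt → 0` as `X = n → +∞`, for `f ∈ L¹` supported in
`[0, κ)` (dominated convergence: the integrand tends to `0` wherever `t < κ`). [folklore] -/
theorem tendsto_cexp_mul_laplace_atTop {f : ℝ → ℂ} {κ : ℝ} (hf : Integrable f)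
    (hsupp : ∀ t, t ∉ Ico 0 κ → f t = 0) :
    Tendsto (fun n : ℕ => cexp (κ * (((-(n : ℝ)) : ℝ) : ℂ)) *
      ∫ t : ℝ, cexp (-(t : ℂ) * (((-(n : ℝ)) : ℝ) : ℂ)) * f t) atTop (𝓝 0) := by
  set F : ℕ → ℝ → ℂ := fun (n : ℕ) (t : ℝ) =>
    cexp (κ * (((-(n : ℝ)) : ℝ) : ℂ)) * (cexp (-(t : ℂ) * (((-(n : ℝ)) : ℝ) : ℂ)) * f t) with hF
  have hFnorm : ∀ (n : ℕ) (t : ℝ), ‖F n t‖ = Real.exp (-((κ - t) * n)) * ‖f t‖ := by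
    intro n t
    simp only [hF]
    rw [norm_mul, norm_mul, ← mul_assoc, Complex.norm_exp, norm_cexp_neg_ofReal_mul,
      ← Real.exp_add, re_ofReal_mul, ofReal_re]
    congr 2
    ring
  have key : Tendsto (fun n : ℕ => ∫ t, F n t) atTop (𝓝 (∫ _ : ℝ, (0 : ℂ))) := by
    refine tendsto_integral_of_dominated_convergence (fun t => ‖f t‖) (fun n => ?_) hf.norm
      (fun n => Eventually.of_forall fun t => ?_) (Eventually.of_forall fun t => ?_)
    · simp only [hF]
      exact ((Continuous.aestronglyMeasurable (by fun_prop)).mul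
        hf.aestronglyMeasurable).const_mul _
    · rw [hFnorm]
      by_cases ht : t ∈ Ico 0 κ
      · refine mul_le_of_le_one_left (norm_nonneg _) (Real.exp_le_one_iff.2 ?_)
        have : 0 ≤ (κ - t) * n := mul_nonneg (sub_pos.2 ht.2).le n.cast_nonneg
        linarith
      · simp [hsupp t ht]
    · by_cases ht : t ∈ Ico 0 κ
      · rw [tendsto_zero_iff_norm_tendsto_zero]
        have h : (fun n : ℕ => ‖F n t‖) = fun n : ℕ => Real.exp (-((κ - t) * n)) * ‖f t‖ :=
          funext fun n => hFnorm n t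
        rw [h]
        simpa using (Real.tendsto_exp_neg_atTop_nhds_zero.comp
          ((tendsto_natCast_atTop_atTop (R := ℝ)).const_mul_atTop (sub_pos.2 ht.2))).mul_const
            ‖f t‖
      · have h : (fun n : ℕ => F n t) = fun _ => 0 := by
          funext n; simp [hF, hsupp t ht]
        rw [h]
        exact tendsto_const_nhds
  rw [integral_zero] at key
  exact key.congr fun n => integral_const_mul _ _

/-! ### Splitting off the tail `[κ, ∞)` -/

/-- For `m ∈ L¹` vanishing a.e. on `(-∞, 0)` and real `X ≥ 0`, the Laplace transform of the
truncation `1_{[0,κ)} m` differs from that of `m` by at most `e^{-κX} ‖m‖₁`. [folklore] -/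
theorem norm_laplace_indicator_Ico_le {m : ℝ → ℂ} (hm : Integrable m)
    (hsupp : ∀ᵐ t ∂volume, t < 0 → m t = 0) (κ : ℝ) {X : ℝ} (hX : 0 ≤ X) :
    ‖∫ t : ℝ, cexp (-(t : ℂ) * X) * (Ico 0 κ).indicator m t‖ ≤
      ‖∫ t : ℝ, cexp (-(t : ℂ) * X) * m t‖ + Real.exp (-κ * X) * ∫ t, ‖m t‖ := by
  set m₁ : ℝ → ℂ := (Ico 0 κ).indicator m with hm₁
  have hm₁i : Integrable m₁ := hm.indicator measurableSet_Ico
  have hker : Continuous fun t : ℝ => cexp (-(t : ℂ) * X) := by fun_prop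
  have hnorm : ∀ t : ℝ, ‖cexp (-(t : ℂ) * X)‖ = Real.exp (-(t * X)) := fun t => by
    rw [norm_cexp_neg_ofReal_mul, ofReal_re]
  -- integrability of the two pieces
  have I₁ : Integrable fun t : ℝ => cexp (-(t : ℂ) * X) * m₁ t := by
    refine Integrable.mono' hm₁i.norm (hker.aestronglyMeasurable.mul hm₁i.aestronglyMeasurable)
      (Eventually.of_forall fun t => ?_)
    rw [norm_mul, hnorm]
    by_cases ht : t ∈ Ico 0 κ
    · refine mul_le_of_le_one_left (norm_nonneg _) (Real.exp_le_one_iff.2 ?_)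
      nlinarith [ht.1]
    · simp [hm₁, ht]
  have hbd₂ : ∀ᵐ (t : ℝ) ∂volume,
      ‖cexp (-(t : ℂ) * X) * (m t - m₁ t)‖ ≤ Real.exp (-κ * X) * ‖m t‖ := by
    filter_upwards [hsupp] with t ht
    rw [norm_mul, hnorm]
    by_cases h : t ∈ Ico 0 κ
    · simp only [hm₁, indicator_of_mem h, sub_self, norm_zero, mul_zero]
      positivity
    · rcases lt_or_ge t 0 with h0 | h0
      · simp [ht h0, hm₁, h]
      · have hκt : κ ≤ t := by
          by_contra h'
          exact h ⟨h0, not_le.1 h'⟩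
        simp only [hm₁, indicator_of_notMem h, sub_zero]
        gcongr
        nlinarith
  have I₂ : Integrable fun t : ℝ => cexp (-(t : ℂ) * X) * (m t - m₁ t) :=
    Integrable.mono' (hm.norm.const_mul _)
      (hker.aestronglyMeasurable.mul (hm.aestronglyMeasurable.sub hm₁i.aestronglyMeasurable)) hbd₂
  have hsplit : (fun t : ℝ => cexp (-(t : ℂ) * X) * m t) =
      fun t : ℝ => cexp (-(t : ℂ) * X) * m₁ t + cexp (-(t : ℂ) * X) * (m t - m₁ t) := by
    funext t; ring
  have hG : ∫ t : ℝ, cexp (-(t : ℂ) * X) * m t =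
      (∫ t : ℝ, cexp (-(t : ℂ) * X) * m₁ t) + ∫ t : ℝ, cexp (-(t : ℂ) * X) * (m t - m₁ t) := by
    rw [hsplit]; exact integral_add I₁ I₂
  have hG₂ : ‖∫ t : ℝ, cexp (-(t : ℂ) * X) * (m t - m₁ t)‖ ≤ Real.exp (-κ * X) * ∫ t, ‖m t‖ := by
    rw [← integral_const_mul]
    exact norm_integral_le_of_norm_le (hm.norm.const_mul _) hbd₂
  calc ‖∫ t : ℝ, cexp (-(t : ℂ) * X) * m₁ t‖
      = ‖(∫ t : ℝ, cexp (-(t : ℂ) * X) * m t) - ∫ t : ℝ, cexp (-(t : ℂ) * X) * (m t - m₁ t)‖ := by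
        rw [hG, add_sub_cancel_right]
    _ ≤ ‖∫ t : ℝ, cexp (-(t : ℂ) * X) * m t‖ + ‖∫ t : ℝ, cexp (-(t : ℂ) * X) * (m t - m₁ t)‖ :=
        norm_sub_le _ _
    _ ≤ ‖∫ t : ℝ, cexp (-(t : ℂ) * X) * m t‖ + Real.exp (-κ * X) * ∫ t, ‖m t‖ := by gcongr

/-! ### The theorem -/

/-- **Exponential decay of the Laplace transform forces vanishing of the density near `0`
(Pólya's indicator theorem for Laplace transforms of `L¹` densities on `[0, ∞)`, real-axis
form).** Let `m ∈ L¹(ℝ)` vanish a.e. on `(-∞, 0)`, let `κ > 0`, and suppose the Laplace transform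
satisfies `‖∫ e^{-tX} m(t) dt‖ ≤ C e^{-κX}` for all real `X ≥ X₀`. Then `m = 0` a.e. on `(-∞, κ)`.
(Boas, *Entire Functions*, §5.3: the conjugate indicator diagram of the Borel–Laplace transform
of a compactly supported density is the convex hull of its support; the present statement is the
case of the direction `θ = π`, `h(π) = -inf supp m`, proved via Phragmén–Lindelöf in the right
half-plane, Liouville, and `L¹` Fourier uniqueness.) [cite: Boas1954, §5.3] -/
theorem ae_eq_zero_of_laplace_exp_decay {m : ℝ → ℂ} (hm : MeasureTheory.Integrable m)
    (hsupp : ∀ᵐ t ∂MeasureTheory.volume, t < 0 → m t = 0) {κ C X₀ : ℝ} (hκ : 0 < κ)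
    (hdecay : ∀ X : ℝ, X₀ ≤ X →
      ‖∫ t : ℝ, Complex.exp (-(t : ℂ) * X) * m t‖ ≤ C * Real.exp (-κ * X)) :
    ∀ᵐ t ∂MeasureTheory.volume, t < κ → m t = 0 := by
  -- the truncation `m₁ = 1_{[0,κ)} m`, its Laplace transform `G₁` and `E = e^{κ z} G₁`
  set m₁ : ℝ → ℂ := (Ico 0 κ).indicator m with hm₁def
  have hm₁ : Integrable m₁ := hm.indicator measurableSet_Ico
  have hsupp₁ : ∀ t, t ∉ Ico 0 κ → m₁ t = 0 := fun t ht => indicator_of_notMem ht _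
  set G₁ : ℂ → ℂ := fun z => ∫ t : ℝ, cexp (-(t : ℂ) * z) * m₁ t with hG₁def
  set E : ℂ → ℂ := fun z => cexp (κ * z) * G₁ z with hEdef
  set M : ℝ := ∫ t, ‖m₁ t‖ with hMdef
  set L : ℝ := ∫ t, ‖m t‖ with hLdef
  have hM0 : 0 ≤ M := integral_nonneg fun t => norm_nonneg _
  have hEd : Differentiable ℂ E :=
    ((differentiable_id.const_mul (κ : ℂ)).cexp).mul
      (differentiable_laplace_of_forall_notMem_Ico hm₁ hsupp₁)
  have hEbound : ∀ z, ‖E z‖ ≤ Real.exp (κ * max z.re 0) * M := fun z =>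
    norm_cexp_mul_laplace_le hm₁ hsupp₁ z
  -- exponential type `κ`
  have hAB : ∀ z, ‖E z‖ ≤ M * Real.exp (κ * ‖z‖) := fun z => by
    refine (hEbound z).trans ?_
    rw [mul_comm]
    gcongr
    exact max_le (re_le_norm z) (norm_nonneg z)
  -- bounded by `M` on the closed left half-plane
  have hleft : ∀ z : ℂ, z.re ≤ 0 → ‖E z‖ ≤ M := fun z hz => by
    have h := hEbound z
    rwa [max_eq_right hz, mul_zero, Real.exp_zero, one_mul] at h
  -- bounded on the positive real axis (the decay hypothesis enters here)
  set X₁ : ℝ := max X₀ 0 with hX₁def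
  set C₁ : ℝ := max (C + L) (Real.exp (κ * X₁) * M) with hC₁def
  have hreal : ∀ x : ℝ, 0 ≤ x → ‖E x‖ ≤ C₁ * Real.exp (0 * x) := fun x hx => by
    rw [zero_mul, Real.exp_zero, mul_one]
    rcases le_or_gt X₁ x with h | h
    · have hX₀ : X₀ ≤ x := (le_max_left _ _).trans h
      have h1 := norm_laplace_indicator_Ico_le hm hsupp κ hx
      have h2 := hdecay x hX₀
      have hx' : Real.exp (κ * x) * Real.exp (-κ * x) = 1 := by
        rw [← Real.exp_add, show κ * x + -κ * x = 0 by ring, Real.exp_zero]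
      calc ‖E x‖ = Real.exp (κ * x) * ‖G₁ x‖ := by
            simp only [hEdef]
            rw [norm_mul, Complex.norm_exp, re_ofReal_mul, ofReal_re]
        _ ≤ Real.exp (κ * x) * (C * Real.exp (-κ * x) + Real.exp (-κ * x) * L) := by
            gcongr
            exact h1.trans (add_le_add h2 le_rfl)
        _ = C * (Real.exp (κ * x) * Real.exp (-κ * x)) +
              Real.exp (κ * x) * Real.exp (-κ * x) * L := by ring
        _ = C + L := by rw [hx', mul_one, one_mul]
        _ ≤ C₁ := le_max_left _ _
    · have h1 := hEbound x
      rw [ofReal_re, max_eq_left hx] at h1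
      calc ‖E x‖ ≤ Real.exp (κ * x) * M := h1
        _ ≤ Real.exp (κ * X₁) * M := by gcongr
        _ ≤ C₁ := le_max_right _ _
  -- bounded by `M` on the imaginary axis
  have himag : ∀ y : ℝ, ‖E (y * I)‖ ≤ M * Real.exp (0 * |y|) := fun y => by
    rw [zero_mul, Real.exp_zero, mul_one]
    exact hleft _ (by simp)
  -- Phragmén–Lindelöf in the right half-plane, then Liouville
  have hright : ∀ z : ℂ, 0 ≤ z.re → ‖E z‖ ≤ max C₁ M := fun z hz => by
    have h := norm_le_exp_of_re_nonneg hEd hAB hreal himag hz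
    rwa [zero_mul, zero_mul, add_zero, Real.exp_zero, mul_one] at h
  have hbdd : IsBounded (range E) := by
    rw [isBounded_iff_forall_norm_le]
    refine ⟨max C₁ M, ?_⟩
    rintro _ ⟨z, rfl⟩
    rcases le_total 0 z.re with hz | hz
    · exact hright z hz
    · exact (hleft z hz).trans (le_max_right _ _)
  have hconst : ∀ z w, E z = E w := fun z w => hEd.apply_eq_apply_of_bounded hbdd z w
  -- the constant is `0`: `E(-n) → 0`
  have hlim : Tendsto (fun n : ℕ => E (((-(n : ℝ)) : ℝ) : ℂ)) atTop (𝓝 0) :=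
    tendsto_cexp_mul_laplace_atTop hm₁ hsupp₁
  have hE0 : E 0 = 0 :=
    tendsto_const_nhds_iff.1 (hlim.congr fun n => hconst _ _)
  have hG₁ : ∀ z, G₁ z = 0 := fun z => by
    have h : E z = 0 := (hconst z 0).trans hE0
    exact (mul_eq_zero.1 h).resolve_left (Complex.exp_ne_zero _)
  -- hence `𝓕 m₁ = 0` and `m₁ = 0` a.e.
  have hF : ∀ ξ : ℝ, 𝓕 m₁ ξ = 0 := fun ξ => by
    rw [Literature.Analysis.Fourier.fourier_eq_fourierLaplace]
    have hexp : ∀ v : ℝ, (((-(2 * π * v)) : ℝ) : ℂ) * (ξ : ℂ) * I = -(v : ℂ) * (2 * π * ξ * I) :=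
      fun v => by push_cast; ring
    simp_rw [hexp]
    exact hG₁ (2 * π * ξ * I)
  have hae : m₁ =ᵐ[volume] 0 :=
    Literature.Analysis.Fourier.ae_eq_zero_of_forall_fourier_eq_zero hm₁ hF
  filter_upwards [hae, hsupp] with t ht hs htκ
  rcases lt_or_ge t 0 with h0 | h0
  · exact hs h0
  · have hmem : t ∈ Ico 0 κ := ⟨h0, htκ⟩
    have h1 : m₁ t = m t := Set.indicator_of_mem hmem m
    rw [← h1, ht, Pi.zero_apply]

end Literature.Analysis.Complex
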